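import Summits.KontsevichZagierPeriods.KontsevichZagierPeriods.Theses.FermatIsogeny
import Summits.KontsevichZagierPeriods.KontsevichZagierPeriods.Theorems.FermatIsogenyBetaLinearSectorHalfIntegers
import Summits.KontsevichZagierPeriods.KontsevichZagierPeriods.Theorems.FermatIsogenyBetaLinearSectorThirds
import Summits.KontsevichZagierPeriods.KontsevichZagierPeriods.Theorems.FermatIsogenyBetaLinearSectorQuarters
import Summits.KontsevichZagierPeriods.KontsevichZagierPeriods.Theorems.FermatIsogenyBetaLinearSectorHalvesThirds
import Summits.KontsevichZagierPeriods.KontsevichZagierPeriods.Theorems.FermatIsogenyBetaLinearSectorIntegerSums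
import Summits.KontsevichZagierPeriods.KontsevichZagierPeriods.Theorems.FermatIsogenyBetaLinearSectorQuartersMax
import Summits.KontsevichZagierPeriods.KontsevichZagierPeriods.Theorems.FermatIsogenyBetaLinearSectorSixthsMax
import Summits.KontsevichZagierPeriods.KontsevichZagierPeriods.Theorems.FermatIsogenyBetaLinearOfProduct
import Summits.KontsevichZagierPeriods.KontsevichZagierPeriods.Theorems.FermatIsogenyFermatSectorCompleteBridges

/-!
# LADDER of crux `BetaProductSector` (stmt-KontsevichZagierPeriods-3898, route FermatIsogeny, rank 4) —
# the LEVEL × DIMENSION gradation, typed; its proved floor; its next rung; and why its limit is the crux itself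

Forward generator G4 `ladder-down` (planner-fwd-ladder-KontsevichZagierPeriods-3898-0, 2026-08-17).  The crux
`C = BetaProductSector` is the summit in another language modulo crux 5
(`FermatSectorCompleteBridges.summit_iff_betaProductSector_of_fermatSectorComplete`).  In C's OWN language the
only gradation parameter that is a literal parameter of C's formula is the LEVEL `N` (the common denominator of
the eight exponents); together with the DIMENSION `k ∈ {1, 2}` (number of Beta factors; `k = 1` is crux 3
`BetaLinearSector`, implied by C through `BetaLinearOfProduct.betaLinearSector_of_betaProductSector`) it gives
the two-parameter family

* `LinRung N`  := crux 3 restricted to exponents in `(1/N)ℤ`   (k = 1),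
* `ProdRung N` := crux 4 = C restricted to exponents in `(1/N)ℤ` (k = 2),
* `LinRungMax N` / `ProdRungMax N` := the same over the MAXIMAL sector of level `N` (each atom `(a,b)` at level
  `N`, OR of Euler type `a + b ∈ ℤ`, OR degenerate `a ∈ ℤ ∨ b ∈ ℤ`) — the shape of the landed
  `QuartersMax.betaLinearSector_quartersMax` / `SixthsMax.betaLinearSector_sixthsMax`.

PROVED FLOOR (all landed `--supports stmt-…-3897`, std axioms): `LinRung 2` (Lindemann), `LinRung 3`, `LinRung 4`,
`LinRung 6`, `LinRungMax 4`, `LinRungMax 6` (Chudnovsky 1976: `π, Γ(1/3)` resp. `π, Γ(1/4)` algebraically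
independent — both PROVED in the tree) — §2, sorry-free specialisations (the F3 witnesses).

NEXT RUNG (one move = the dimension, F1): `ProdRung 4` — Conjecture 1 for every pair (product of two Beta
integrals with quarter-integer parameters, real-algebraic multiple of another such product) — and its maximal
form `ProdRungMax 4`; likewise `ProdRung 3`, `ProdRung 6`, `ProdRungMax 6`, `ProdRung 2`.  Located reason the
floor's proof stops (Attack): tensoring the two one-dimensional normal forms leaves exactly ONE cross-class
coincidence per Chudnovsky level — `T₂ ⊗ T₃` and `T₀ ⊗ T₁` both have value class `π`
(`Γ(1/4)²/√π · π√π/Γ(1/4)² = π`): Euler's lemniscate identity `B(1/4,1/2)·B(3/4,1/2) = 4π` at level 4, the `F₃`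
duality `B(1/3,1/3)·B(2/3,2/3) = 2√3·π` at level 3, `B(1/3,1/2)·B(5/6,1/2) = 3π` at level 6 — which no tensor
product of one-dimensional chains produces; it is ONE Dirichlet re-association through the simplex
(`BetaProductSectorStubs.stub_dirichletReassociation`, LANDED p149535) at `(a,b,k) = (1/4,1/2,1/2)`,
`(1/3,1/3,2/3)`, `(1/3,1/2,1/2)`.  Every other ingredient is landed (level reduction and normal forms of the
linear files, `KZ.Equivalent.prod`, the coordinate swap, `Thirds.monomial_ne_algebraic_mul_monomial` for the
separation of the nine product classes `π^i Γ(1/4)^j`).  So the next rungs are PROVABLE NOW (L each).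

WHY NO ROUTE IS OPENED ON THIS LADDER (§3, kernel-checked): the family is antitone in divisibility
(`prodRung_of_dvd`) and its limit IS the crux (`betaProductSector_iff_forall_prodRung`): the tail
`∀ N, ProdRung N` is C restated (forbidden to file), and any level rung is dominated by its complement
(Deligne-proportional partners at non-Chudnovsky levels), so no honest `closes` makes a level rung
load-bearing.  The rungs are BANKABLE THEOREMS of the crux (to be landed `--supports stmt-KontsevichZagierPeriods-3898`,
exactly as crux 3's level rungs were), not route cruxes.  LADDER CEILING (BC9): capped at the Chudnovsky sectors
`{¼ℤ ∪ Euler ∪ degenerate}²` and `{⅙ℤ ∪ Euler ∪ degenerate}²` separately (mixing `Γ(1/3)` with `Γ(1/4)`, level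
5, 8, 9, 12, … need algebraic-independence results that do not exist); the lift is the transcendence atom
`BetaProductHodgeType` (Lang–Rohrlich (2,2)), typed as the strategist's split child of this crux.
Dossier: `Cruxes/BetaProductSector/LADDER.md`.

References: Kontsevich–Zagier 2001 §1.2; G. V. Chudnovsky, *Contributions to the theory of transcendental
numbers* (1984) Ch. 7; M. Waldschmidt, *Transcendence of periods: the state of the art* (2006); Andrews–Askey–Roy
1999 Thm 1.8.1 (Dirichlet); P. Das, Trans. AMS 352 (2000).
-/

noncomputable section

set_option linter.dupNamespace false

namespace Summit.KontsevichZagierPeriods.KontsevichZagierPeriods.Cruxes.BetaProductSector.Ladder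

open Literature.NumberTheory.Transcendental
open Summit.KontsevichZagierPeriods.KontsevichZagierPeriods.Theses.FermatIsogeny (BetaProductSector BetaLinearSector FermatSectorComplete)
open Summit.KontsevichZagierPeriods.FermatIsogeny.BetaLinearSector

/-! ## §1 The graded family (level `N`, dimension `k ∈ {1,2}`) -/

/-- `LinRung N` — crux 3 `BetaLinearSector` restricted to LEVEL `N` (all four exponents in `(1/N)ℤ`); verbatim the
shape of the landed rungs `betaLinearSector_halfIntegers/_thirds/_quarters/_sixths`. [cite: KontsevichZagier2001, §1.2 Conjecture 1] -/
def LinRung (N : ℕ) : Prop :=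
  ∀ (a b a' b' : ℚ) (c : ℝ), 0 < a → 0 < b → 0 < a' → 0 < b' → IsAlgebraic ℚ c →
    (∃ m : ℤ, a = m / N) → (∃ m : ℤ, b = m / N) → (∃ m : ℤ, a' = m / N) → (∃ m : ℤ, b' = m / N) →
    ∀ (r r' : KZ.IntegralRep 1), r.domain = {x | x 0 ∈ Set.Ioo (0:ℝ) 1} →
    Set.EqOn r.integrand (fun x => (x 0) ^ ((a:ℝ) - 1) * (1 - x 0) ^ ((b:ℝ) - 1)) r.domain →
    r'.domain = {x | x 0 ∈ Set.Ioo (0:ℝ) 1} →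
    Set.EqOn r'.integrand (fun x => c * (x 0) ^ ((a':ℝ) - 1) * (1 - x 0) ^ ((b':ℝ) - 1)) r'.domain →
    r.value = r'.value → KZ.Equivalent r r'

/-- `ProdRung N` — crux 4 `BetaProductSector` (= C, VERBATIM) restricted to LEVEL `N` (all eight exponents in
`(1/N)ℤ`): Conjecture 1 for (product of two Beta integrals on `(0,1)²`, real-algebraic multiple of another) at
level `N`.  THE NEXT RUNG of the ladder is `ProdRung 4` (and `ProdRung 3`, `ProdRung 6`, `ProdRung 2`).
[cite: KontsevichZagier2001, §1.2 Conjecture 1] -/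
def ProdRung (N : ℕ) : Prop :=
  ∀ (a b e d a' b' e' d' : ℚ) (q : ℝ), 0 < a → 0 < b → 0 < e → 0 < d → 0 < a' → 0 < b' → 0 < e' → 0 < d' →
    IsAlgebraic ℚ q →
    (∃ m : ℤ, a = m / N) → (∃ m : ℤ, b = m / N) → (∃ m : ℤ, e = m / N) → (∃ m : ℤ, d = m / N) →
    (∃ m : ℤ, a' = m / N) → (∃ m : ℤ, b' = m / N) → (∃ m : ℤ, e' = m / N) → (∃ m : ℤ, d' = m / N) →
    ∀ (r r' : KZ.IntegralRep 2), r.domain = {x | ∀ i, x i ∈ Set.Ioo (0:ℝ) 1} →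
    Set.EqOn r.integrand (fun x => (x 0) ^ ((a:ℝ) - 1) * (1 - x 0) ^ ((b:ℝ) - 1) * (x 1) ^ ((e:ℝ) - 1) *
      (1 - x 1) ^ ((d:ℝ) - 1)) r.domain →
    r'.domain = {x | ∀ i, x i ∈ Set.Ioo (0:ℝ) 1} →
    Set.EqOn r'.integrand (fun x => q * (x 0) ^ ((a':ℝ) - 1) * (1 - x 0) ^ ((b':ℝ) - 1) * (x 1) ^ ((e':ℝ) - 1) *
      (1 - x 1) ^ ((d':ℝ) - 1)) r'.domain →
    r.value = r'.value → KZ.Equivalent r r'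

/-- The MAXIMAL level-`N` sector predicate on one Beta atom `(a,b)`: level `N`, OR Euler type (`a + b ∈ ℤ`), OR
degenerate (`a ∈ ℤ ∨ b ∈ ℤ`) — verbatim the disjunction of `betaLinearSector_quartersMax/_sixthsMax`.
[cite: KontsevichZagier2001, §1.2 Conjecture 1] -/
def MaxAtom (N : ℕ) (a b : ℚ) : Prop :=
  ((∃ m : ℤ, a = m / N) ∧ (∃ m : ℤ, b = m / N)) ∨ (∃ m : ℤ, a + b = m) ∨ (∃ m : ℤ, a = m) ∨ (∃ m : ℤ, b = m)

/-- `LinRungMax N` — crux 3 on the MAXIMAL level-`N` sector (both atoms `MaxAtom N`); the landed theorems are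
`N = 4` (the maximal `(π, Γ(1/4))` sector) and `N = 6` (the maximal `(π, Γ(1/3))` sector). [cite: KontsevichZagier2001, §1.2 Conjecture 1] -/
def LinRungMax (N : ℕ) : Prop :=
  ∀ (a b a' b' : ℚ) (c : ℝ), 0 < a → 0 < b → 0 < a' → 0 < b' → IsAlgebraic ℚ c →
    MaxAtom N a b → MaxAtom N a' b' →
    ∀ (r r' : KZ.IntegralRep 1), r.domain = {x | x 0 ∈ Set.Ioo (0:ℝ) 1} →
    Set.EqOn r.integrand (fun x => (x 0) ^ ((a:ℝ) - 1) * (1 - x 0) ^ ((b:ℝ) - 1)) r.domain →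
    r'.domain = {x | x 0 ∈ Set.Ioo (0:ℝ) 1} →
    Set.EqOn r'.integrand (fun x => c * (x 0) ^ ((a':ℝ) - 1) * (1 - x 0) ^ ((b':ℝ) - 1)) r'.domain →
    r.value = r'.value → KZ.Equivalent r r'

/-- `ProdRungMax N` — crux 4 on the MAXIMAL level-`N` product sector (all four atoms `MaxAtom N`): the CEILING RUNGS
of this ladder are `ProdRungMax 4` and `ProdRungMax 6` (beyond them the transcendence input is missing in print).
[cite: KontsevichZagier2001, §1.2 Conjecture 1] -/
def ProdRungMax (N : ℕ) : Prop :=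
  ∀ (a b e d a' b' e' d' : ℚ) (q : ℝ), 0 < a → 0 < b → 0 < e → 0 < d → 0 < a' → 0 < b' → 0 < e' → 0 < d' →
    IsAlgebraic ℚ q → MaxAtom N a b → MaxAtom N e d → MaxAtom N a' b' → MaxAtom N e' d' →
    ∀ (r r' : KZ.IntegralRep 2), r.domain = {x | ∀ i, x i ∈ Set.Ioo (0:ℝ) 1} →
    Set.EqOn r.integrand (fun x => (x 0) ^ ((a:ℝ) - 1) * (1 - x 0) ^ ((b:ℝ) - 1) * (x 1) ^ ((e:ℝ) - 1) *
      (1 - x 1) ^ ((d:ℝ) - 1)) r.domain →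
    r'.domain = {x | ∀ i, x i ∈ Set.Ioo (0:ℝ) 1} →
    Set.EqOn r'.integrand (fun x => q * (x 0) ^ ((a':ℝ) - 1) * (1 - x 0) ^ ((b':ℝ) - 1) * (x 1) ^ ((e':ℝ) - 1) *
      (1 - x 1) ^ ((d':ℝ) - 1)) r'.domain →
    r.value = r'.value → KZ.Equivalent r r'

/-! ## §2 The proved floor — sorry-free specialisations (F3 witnesses) -/

/-- FLOOR, level 2 (Wallis sector; Lindemann): `LinRung 2` is the landed `HalfIntegers.betaLinearSector_halfIntegers` (p149261).
[cite: KontsevichZagier2001, §1.2 Conjecture 1] -/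
theorem linRung_two : LinRung 2 := fun a b a' b' c ha hb ha' hb' hc h₁ h₂ h₃ h₄ =>
  HalfIntegers.betaLinearSector_halfIntegers a b a' b' c ha hb ha' hb' hc (by simpa using h₁) (by simpa using h₂)
    (by simpa using h₃) (by simpa using h₄)

/-- FLOOR, level 3 (Chudnovsky `π, Γ(1/3)`): `LinRung 3` is the landed `Thirds.betaLinearSector_thirds` (p153947).
[cite: KontsevichZagier2001, §1.2 Conjecture 1] -/
theorem linRung_three : LinRung 3 := fun a b a' b' c ha hb ha' hb' hc h₁ h₂ h₃ h₄ =>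
  Thirds.betaLinearSector_thirds a b a' b' c ha hb ha' hb' hc (by simpa using h₁) (by simpa using h₂)
    (by simpa using h₃) (by simpa using h₄)

/-- FLOOR, level 4 (lemniscatic; Chudnovsky `π, Γ(1/4)`): `LinRung 4` is the landed `Quarters.betaLinearSector_quarters`
(p156804) — THE FLOOR OF THE NEXT RUNG `ProdRung 4`. [cite: KontsevichZagier2001, §1.2 Conjecture 1] -/
theorem linRung_four : LinRung 4 := fun a b a' b' c ha hb ha' hb' hc h₁ h₂ h₃ h₄ =>
  Quarters.betaLinearSector_quarters a b a' b' c ha hb ha' hb' hc (by simpa using h₁) (by simpa using h₂)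
    (by simpa using h₃) (by simpa using h₄)

/-- FLOOR, level 6 (Chudnovsky `π, Γ(1/3)`; three CM-isogeny links): `LinRung 6` is the landed
`SixthsMax.betaLinearSector_sixths`. [cite: KontsevichZagier2001, §1.2 Conjecture 1] -/
theorem linRung_six : LinRung 6 := fun a b a' b' c ha hb ha' hb' hc h₁ h₂ h₃ h₄ =>
  SixthsMax.betaLinearSector_sixths a b a' b' c ha hb ha' hb' hc (by simpa using h₁) (by simpa using h₂)
    (by simpa using h₃) (by simpa using h₄)

/-- FLOOR, maximal `(π, Γ(1/4))` sector: `LinRungMax 4` is the landed `QuartersMax.betaLinearSector_quartersMax` (p162245).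
[cite: KontsevichZagier2001, §1.2 Conjecture 1] -/
theorem linRungMax_four : LinRungMax 4 := fun a b a' b' c ha hb ha' hb' hc h₁ h₂ =>
  QuartersMax.betaLinearSector_quartersMax a b a' b' c ha hb ha' hb' hc (by simpa [MaxAtom] using h₁)
    (by simpa [MaxAtom] using h₂)

/-- FLOOR, maximal `(π, Γ(1/3))` sector: `LinRungMax 6` is the landed `SixthsMax.betaLinearSector_sixthsMax`.
[cite: KontsevichZagier2001, §1.2 Conjecture 1] -/
theorem linRungMax_six : LinRungMax 6 := fun a b a' b' c ha hb ha' hb' hc h₁ h₂ =>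
  SixthsMax.betaLinearSector_sixthsMax a b a' b' c ha hb ha' hb' hc (by simpa [MaxAtom] using h₁)
    (by simpa [MaxAtom] using h₂)

/-! ## §3 Logical position of the family: antitone in divisibility, limit = the crux, top = the summit -/

/-- Arithmetic of levels: a rational whose (reduced) denominator divides `N ≠ 0` has level `N`. [folklore] -/
theorem exists_eq_div_of_den_dvd (x : ℚ) {N : ℕ} (hN : N ≠ 0) (h : x.den ∣ N) : ∃ m : ℤ, x = m / N := by
  obtain ⟨k, hk⟩ := h
  have hk0 : (k : ℚ) ≠ 0 := by
    have : k ≠ 0 := by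
      rintro rfl
      exact hN (by simpa using hk)
    exact_mod_cast this
  have hd0 : (x.den : ℚ) ≠ 0 := by exact_mod_cast x.den_nz
  refine ⟨x.num * k, ?_⟩
  rw [hk]
  push_cast
  rw [mul_div_mul_right _ _ hk0]
  exact (Rat.num_div_den x).symm

/-- Arithmetic of levels: level `N` implies level `N * k` (`k ≠ 0`). [folklore] -/
theorem exists_eq_div_mul {x : ℚ} {N k : ℕ} (hk : k ≠ 0) (h : ∃ m : ℤ, x = m / N) :
    ∃ m : ℤ, x = m / ((N * k : ℕ) : ℚ) := by
  obtain ⟨m, hm⟩ := h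
  have hk0 : (k : ℚ) ≠ 0 := by exact_mod_cast hk
  refine ⟨m * k, ?_⟩
  push_cast
  rw [mul_div_mul_right _ _ hk0]
  exact hm

/-- THE FAMILY IS ANTITONE IN DIVISIBILITY: `ProdRung (N * k) → ProdRung N` (`k ≠ 0`) — a higher level contains
every instance of a lower one.  (This is why level rungs are never load-bearing conjuncts of C.) [folklore] -/
theorem prodRung_of_dvd {N k : ℕ} (hk : k ≠ 0) (h : ProdRung (N * k)) : ProdRung N :=
  fun a b e d a' b' e' d' q ha hb he hd ha' hb' he' hd' hq h₁ h₂ h₃ h₄ h₅ h₆ h₇ h₈ =>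
    h a b e d a' b' e' d' q ha hb he hd ha' hb' he' hd' hq (exists_eq_div_mul hk h₁) (exists_eq_div_mul hk h₂)
      (exists_eq_div_mul hk h₃) (exists_eq_div_mul hk h₄) (exists_eq_div_mul hk h₅) (exists_eq_div_mul hk h₆)
      (exists_eq_div_mul hk h₇) (exists_eq_div_mul hk h₈)

/-- Every level rung is a consequence of the crux (drop the level hypotheses). [folklore] -/
theorem prodRung_of_betaProductSector (h : BetaProductSector) (N : ℕ) : ProdRung N :=
  fun a b e d a' b' e' d' q ha hb he hd ha' hb' he' hd' hq _ _ _ _ _ _ _ _ =>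
    h a b e d a' b' e' d' q ha hb he hd ha' hb' he' hd' hq

/-- THE LIMIT OF THE LADDER IS THE CRUX ITSELF: `BetaProductSector ↔ ∀ N ≠ 0, ProdRung N` (take `N` = the product
of the eight denominators).  Hence the tail of the level ladder may not be filed (it is C restated).
[cite: KontsevichZagier2001, §1.2 Conjecture 1] -/
theorem betaProductSector_iff_forall_prodRung : BetaProductSector ↔ ∀ N : ℕ, N ≠ 0 → ProdRung N := by
  refine ⟨fun h N _ => prodRung_of_betaProductSector h N, fun h => ?_⟩
  intro a b e d a' b' e' d' q ha hb he hd ha' hb' he' hd' hq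
  set N : ℕ := a.den * b.den * e.den * d.den * a'.den * b'.den * e'.den * d'.den with hN
  have hN0 : N ≠ 0 := by
    simp only [hN]
    exact Nat.ne_of_gt (by positivity)
  refine h N hN0 a b e d a' b' e' d' q ha hb he hd ha' hb' he' hd' hq ?_ ?_ ?_ ?_ ?_ ?_ ?_ ?_
  · exact exists_eq_div_of_den_dvd a hN0 ⟨b.den * e.den * d.den * a'.den * b'.den * e'.den * d'.den, by simp only [hN]; ring⟩
  · exact exists_eq_div_of_den_dvd b hN0 ⟨a.den * e.den * d.den * a'.den * b'.den * e'.den * d'.den, by simp only [hN]; ring⟩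
  · exact exists_eq_div_of_den_dvd e hN0 ⟨a.den * b.den * d.den * a'.den * b'.den * e'.den * d'.den, by simp only [hN]; ring⟩
  · exact exists_eq_div_of_den_dvd d hN0 ⟨a.den * b.den * e.den * a'.den * b'.den * e'.den * d'.den, by simp only [hN]; ring⟩
  · exact exists_eq_div_of_den_dvd a' hN0 ⟨a.den * b.den * e.den * d.den * b'.den * e'.den * d'.den, by simp only [hN]; ring⟩
  · exact exists_eq_div_of_den_dvd b' hN0 ⟨a.den * b.den * e.den * d.den * a'.den * e'.den * d'.den, by simp only [hN]; ring⟩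
  · exact exists_eq_div_of_den_dvd e' hN0 ⟨a.den * b.den * e.den * d.den * a'.den * b'.den * d'.den, by simp only [hN]; ring⟩
  · exact exists_eq_div_of_den_dvd d' hN0 ⟨a.den * b.den * e.den * d.den * a'.den * b'.den * e'.den, by simp only [hN]; ring⟩

/-- Every rung is a consequence of the SUMMIT (F4: rungs are consequences of S; the other end is pinned to the
proved floor of §2): `S → C` unconditionally (`GammaHodgeSectorNegative.core_of_summit`), then §3.
[cite: KontsevichZagier2001, §1.2 Conjecture 1] -/
theorem prodRung_of_summit (h : _root_.KontsevichZagierPeriods) (N : ℕ) : ProdRung N :=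
  prodRung_of_betaProductSector
    (fun _ _ _ _ _ _ _ _ _ _ _ _ _ _ _ _ _ _ ρ ρ' _ _ _ _ hv =>
      Summit.KontsevichZagierPeriods.GammaHodgeSectorNegative.core_of_summit h ρ ρ' hv) N

/-- The dimension step of the family at a fixed level, downwards (the rung specialises to the floor's STATEMENT at the
level of the whole family): `(∀ N ≠ 0, ProdRung N) → ∀ N, LinRung N` by `β(1,1)`-padding
(`betaLinearSector_of_betaProductSector`). [cite: KontsevichZagier2001, §1.2 Conjecture 1] -/
theorem linRung_of_forall_prodRung (h : ∀ N : ℕ, N ≠ 0 → ProdRung N) (N : ℕ) : LinRung N :=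
  fun a b a' b' c ha hb ha' hb' hc _ _ _ _ =>
    Summit.KontsevichZagierPeriods.FermatIsogeny.BetaLinearOfProduct.betaLinearSector_of_betaProductSector
      (betaProductSector_iff_forall_prodRung.2 h) a b a' b' c ha hb ha' hb' hc

/-- TOP OF THE LADDER: with crux 5 `FermatSectorComplete` the tail of the family IS the summit
(`summit_iff_betaProductSector_of_fermatSectorComplete`, the landed top equivalence of this G4 seed).
[cite: KontsevichZagier2001, §1.2 Conjecture 1] -/
theorem summit_iff_forall_prodRung (h₅ : FermatSectorComplete) :
    _root_.KontsevichZagierPeriods ↔ ∀ N : ℕ, N ≠ 0 → ProdRung N :=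
  (Summit.KontsevichZagierPeriods.FermatIsogeny.FermatSectorCompleteBridges.summit_iff_betaProductSector_of_fermatSectorComplete
      h₅).trans betaProductSector_iff_forall_prodRung

end Summit.KontsevichZagierPeriods.KontsevichZagierPeriods.Cruxes.BetaProductSector.Ladder

end
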